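import Mathlib.Analysis.InnerProductSpace.Basic
import HarnessLib

/-!
# REPAIR-CATALOGUE row RC-322 (Geiger 2026): Lemma V.1 «rank-one secular kernel» — the source's algebraic by-product behind M5, PROVED

PROOF-ONLY record file (no definition) of the abc-iut cell, D-0123(C) REPAIR-CATALOGUE, floating tester abc-iut-rcat-tst-7 (source
`paper:doi-10-5281-zenodo-20541632`, bib `Geiger2026Cor312Gap`, Lemma V.1 p.6: «Let T_J = T₀ + c|q̂⟩⟨q̂| be a rank-one perturbation of
T₀, where q̂ ⊥ 1 … and T₀|_H is invertible. If the secular condition 1 + c⟨q̂, T₀⁻¹ q̂⟩ ≠ 0 holds, then ker(T_J) = span(1)»; the source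
itself marks it «an algebraic by-product … not used in the proof of Theorem V.5»). Typed abstractly over a real inner-product space with a
distinguished vector `u` («1», in the kernel of `T₀`), `q ⊥ u`, and a left inverse `S` of `T₀` on the hyperplane `u^⊥` (the source's
«T₀|_H invertible»). Classical linear algebra; mentions no Θ-datum; no side on [IUTchIII] Cor. 3.12 or on any author; nothing asserts abc
proved or refuted. [claim: Geiger2026Cor312Gap, status: under-review]
-/

namespace Summit.ABC.IUTFork.Repair.RcatGeiger.SecularKernel

open RealInnerProductSpace

variable {V : Type*} [NormedAddCommGroup V] [InnerProductSpace ℝ V]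

/-- **Lemma V.1 (rank-one secular kernel), PROVED.** Let `T₀ u = 0`, `⟪q, u⟫ = 0`, let `S` invert `T₀` on the hyperplane `u^⊥`
(`S (T₀ h) = h` whenever `⟪h, u⟫ = 0`), `u ≠ 0`, and assume the secular condition `1 + c·⟪q, S q⟫ ≠ 0`. Then the kernel of the rank-one
perturbation `T_J f := T₀ f + (c·⟪q, f⟫)·q` is exactly the line spanned by `u`. [claim: Geiger2026Cor312Gap, status: under-review] -/
theorem ker_rankOne_perturbation_eq_span (T₀ S : V →ₗ[ℝ] V) (u q : V) (c : ℝ)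
    (hu : T₀ u = 0) (hq : ⟪q, u⟫ = 0) (hS : ∀ h : V, ⟪h, u⟫ = 0 → S (T₀ h) = h)
    (hsec : 1 + c * ⟪q, S q⟫ ≠ 0) (hu0 : u ≠ 0) (f : V) :
    T₀ f + (c * ⟪q, f⟫) • q = 0 ↔ ∃ α : ℝ, f = α • u := by
  constructor
  · intro hf
    -- decompose f = α u + h with h ⊥ u
    set α : ℝ := ⟪f, u⟫ / ⟪u, u⟫ with hα
    set h : V := f - α • u with hh
    have huu : ⟪u, u⟫ ≠ 0 := by
      rw [real_inner_self_eq_norm_sq]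
      exact pow_ne_zero 2 (norm_ne_zero_iff.mpr hu0)
    have hhu : ⟪h, u⟫ = 0 := by
      rw [hh, inner_sub_left, real_inner_smul_left, hα, div_mul_cancel₀ _ huu, sub_self]
    have hqf : ⟪q, f⟫ = ⟪q, h⟫ := by
      rw [hh, inner_sub_right, real_inner_smul_right, hq, mul_zero, sub_zero]
    have hT : T₀ f = T₀ h := by
      rw [hh, map_sub, map_smul, hu, smul_zero, sub_zero]
    -- T₀ h = −(c⟪q,h⟫) • q
    have hTh : T₀ h = -((c * ⟪q, h⟫) • q) := by
      rw [← hT, ← hqf]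
      exact eq_neg_of_add_eq_zero_left hf
    -- apply S: h = −(c⟪q,h⟫) • S q
    have hhS : h = -((c * ⟪q, h⟫) • S q) := by
      have := hS h hhu
      rw [hTh, map_neg, map_smul] at this
      exact this.symm
    -- pair with q: ⟪q,h⟫ (1 + c ⟪q, S q⟫) = 0
    have hqh : ⟪q, h⟫ = 0 := by
      have hpair : ⟪q, h⟫ = -(c * ⟪q, h⟫ * ⟪q, S q⟫) := by
        conv_lhs => rw [hhS]
        rw [inner_neg_right, real_inner_smul_right]
      have : ⟪q, h⟫ * (1 + c * ⟪q, S q⟫) = 0 := by linear_combination hpair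
      rcases mul_eq_zero.mp this with h0 | h0
      · exact h0
      · exact absurd h0 hsec
    have h0 : h = 0 := by rw [hhS, hqh, mul_zero, zero_smul, neg_zero]
    refine ⟨α, ?_⟩
    have : f - α • u = 0 := by rw [← hh, h0]
    exact sub_eq_zero.mp this
  · rintro ⟨α, rfl⟩
    rw [map_smul, hu, smul_zero, real_inner_smul_right, hq, mul_zero, mul_zero, zero_smul, add_zero]

end Summit.ABC.IUTFork.Repair.RcatGeiger.SecularKernel
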